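import Literature.NumberTheory.GaloisRepresentations.ArtinRepresentation
import Literature.NumberTheory.GaloisRepresentations.ArtinConductorIntegralityProofs
import Literature.NumberTheory.GaloisRepresentations.HerbrandQuotientFormula
import Literature.NumberTheory.GaloisRepresentations.RamificationGalois
import Mathlib.RingTheory.DedekindDomain.Different
import HarnessLib

/-!
# Hilbert's different formula `v_𝔓(𝔇) = Σ_{s ≠ 1} i_G(s)` and the integrality of the different exponent (Serre IV §1 Prop. 4 and Corollary), proved

`ArtinRepresentation.lean` vendors, as the named fact `Literature.card_inf_inertia_dvd_finsum_lowerIndex R`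
(Serre, *Local Fields*, Ch. IV §1, Corollary to Prop. 4, in numerator form), the arithmetic input
of the induction formula in Artin's proof of the integrality of the conductor (Ch. VI §2, Prop. 4):
for a Dedekind domain `R` with fraction field `K`, a finite Galois extension `L/K` with group `G`,
a maximal ideal `𝔓` of `S_L = integralClosure R L` with separable residue extension and a subgroup
`H ≤ G`, **`|H ∩ G_0|` divides `Σ_{s ∉ H} i_G(s)`** (the quotient being `v_{𝔓 ∩ K'}(𝔇_{K'/K})`,
`K' = L^H`).  This file proves it (`Literature.NumberTheory.GaloisRepresentations.card_inf_inertia_dvd_finsum_lowerIndex_holds`), following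
Serre's proof — Hilbert's formula for the different (Prop. 4) and the transitivity of the
different (Ch. III §4, Prop. 8) — but globally, at a prime of a Dedekind extension, Mathlib having
no completions of Dedekind domains with their Galois theory:

* `Literature.NumberTheory.GaloisRepresentations.emultiplicity_differentIdeal_eq_finsum_lowerIndex` — **Hilbert's formula at a prime fixed
  by the group** (Prop. 4, global form): for an intermediate field `F` with `Gal(L/F)` contained in
  the decomposition group `D_𝔓` (in Serre's complete setting `D_𝔓 = G`, and this is Prop. 4
  verbatim), `v_𝔓(𝔇_{S_L/S_F}) = Σ_{s ∈ Gal(L/F), s ≠ 1} i_G(s)`.  Proof as printed: a generator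
  `x` with `d S_L ⊆ S_F[x]`, `d ∉ 𝔓` (Ch. III §6 Prop. 12 in the global form
  `Literature.NumberTheory.GaloisRepresentations.exists_generator_smul_mem_adjoin` of `HerbrandQuotientFormula.lean`), for which
  `i_G(s) = v_𝔓(s x - x)` (Lemma IV.1.1, `Literature.NumberTheory.GaloisRepresentations.lowerIndex_eq_ordIdeal`); its minimal polynomial over
  `S_F` is `f = ∏_{s ∈ Gal(L/F)} (X - s x)` (the `s x` are pairwise distinct as `i_G(s) < ∞` for
  `s ≠ 1`, and `[L : F] = |Gal(L/F)|`), so `x` generates `L/F` and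
  `f'(x) = ∏_{s ≠ 1} (x - s x)`; and `𝔯 · 𝔇_{S_L/S_F} = (f'(x))` with `𝔯` the conductor of
  `S_F[x]` (Ch. III §6, Cor. 1 to Prop. 11 — Mathlib's `conductor_mul_differentIdeal`), where
  `d ∈ 𝔯`, so `𝔓 ∤ 𝔯`.
* `Literature.NumberTheory.GaloisRepresentations.emultiplicity_differentIdeal_eq_add` — **transitivity of the different read off at `𝔓`**
  (Ch. III §4 Prop. 8, Mathlib's `differentIdeal_eq_differentIdeal_mul_differentIdeal`): for
  `F₁ ≤ F₂`, `v_𝔓(𝔇_{S_L/S_{F₁}}) = v_𝔓(𝔇_{S_L/S_{F₂}}) + e(𝔓 | 𝔓 ∩ F₂) v_{𝔓 ∩ F₂}(𝔇_{S_{F₂}/S_{F₁}})`.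
* `Literature.NumberTheory.GaloisRepresentations.card_inf_inertia_dvd_finsum_lowerIndex_holds` — the Corollary: with `D = D_𝔓`,
  `F₁ = L^D`, `F₂ = L^{H ∩ D}` (so `Gal(L/F₂) = H ∩ D ≤ D = Gal(L/F₁)`), the two instances of
  Hilbert's formula and transitivity give
  `Σ_{s ∈ D ∖ H} i_G(s) = e(𝔓 | 𝔓 ∩ F₂) · v_{𝔓 ∩ F₂}(𝔇_{S_{F₂}/S_{F₁}})`, while `i_G(s) = 0` off
  `D` and `e(𝔓 | 𝔓 ∩ F₂) = |T_𝔓 ∩ (H ∩ D)| = |H ∩ G_0|` (`Literature.NumberTheory.GaloisRepresentations.ramificationIdx'_under_eq_card_inertia`).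
  (At `𝔓 = 0`, possible only when `L = K`, all `i_G(s)`, `s ≠ 1`, vanish.)

With this, the corrected Artin–Katz integrality statement
`Literature.NumberTheory.GaloisRepresentations.GaloisRep.exists_natCast_eq_artinConductorAt_of_hasOpenInertiaKerAt` depends, through
`ArtinRepresentationProofs.lean` and `ArtinConductorHerbrandProofs.lean`, only on the named facts
`Literature.RepresentationTheory.FiniteGroups.brauer_induction`, `Literature.NumberTheory.GaloisRepresentations.card_inf_inertia_dvd_finsum_card_inf_ramificationSubgroup`
(VI §2 Cor. to Prop. 5, below which lies `Literature.NumberTheory.GaloisRepresentations.hasseArf`) and, for coefficients of positive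
characteristic, `Literature.NumberTheory.GaloisRepresentations.exists_natCast_eq_artinExponent_finiteField`.

## Implementation notes

Theorems only (no new definitions or instances).  `S_F = integralClosure R F` and `S_L` are
subalgebras (of `F`, `L`), and Mathlib's different and its transitivity live on
`FractionRing S_F → FractionRing S_L`; instance problems such as `SMul S_F (FractionRing _)` or
`IsScalarTower S_F _ _` first try the generic subalgebra instances, which wander through actions of
`F` and `L` and time out.  The proofs therefore put the intended localization instances
(`OreLocalization.instAlgebra`, `FractionRing.liftAlgebra`, …) into the context with `letI`,
reuse the local `S_F`-algebra structure `Literature.NumberTheory.GaloisRepresentations.integralClosureAlgebra` and the residue-algebra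
shortcuts of `RamificationGalois.lean`, state the transitivity step for an arbitrary compatible
`S_{F₁}`-algebra structure on `S_{F₂}`, and instantiate it with the inclusion for `F₁ ≤ F₂`
(`AlgHom.mapIntegralClosure` of `IntermediateField.inclusion`).  Separability of
`Frac(S_L)/Frac(S_F)` is transported from `L/F` (`Algebra.IsSeparable.of_equiv_equiv`, as in
Mathlib's `DedekindDomain/LinearDisjoint.lean`).

## References

* J.-P. Serre, *Local Fields*, GTM 67, Springer 1979: Ch. III §4 Prop. 8 (transitivity of the
  different), §6 Prop. 11 with Cor. 1–2 (`(f'(x)) = 𝔯 𝔇_{B/A}`) and Prop. 12 (monogenicity);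
  Ch. IV §1 Lemma 1, Prop. 4 (`v_L(𝔇_{L/K}) = Σ_{s ≠ 1} i_G(s)`), Corollary
  (`v_{K'}(𝔇_{K'/K}) = (1/e') Σ_{s ∉ H} i_G(s)`, p. 64) and Remark 2 (globalisation).
  [SerreLocalFields1979]
* J. Neukirch, *Algebraic Number Theory*, Springer 1999, Ch. III §2, (2.2)–(2.5) (different:
  transitivity, localisation, `𝔇 = (f'(α))` with the conductor), Ch. II §10. [NeukirchANT1999]
-/

open Polynomial

noncomputable section

namespace Literature.NumberTheory.GaloisRepresentations

attribute [local instance] FractionRing.liftAlgebra FractionRing.isScalarTower_liftAlgebra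

variable (R : Type*) {K L : Type*} [CommRing R] [Field K] [Field L] [Algebra R K] [Algebra R L]
  [Algebra K L] [IsScalarTower R K L]

attribute [local instance] integralClosureAlgebra integralClosure_isScalarTower_left
  integralClosure_isScalarTower_bot integralClosure_faithfulSMul integralClosure_isIntegral
  integralClosure_isTorsionFree isMaximal_under_integralClosure under_integralClosure_liesOver
  residueAlgebra residueSMul isScalarTower_residue

variable [IsDedekindDomain R] [IsFractionRing R K] [FiniteDimensional K L]

attribute [local instance] integralClosure_moduleFinite

variable [IsGalois K L]

/-! ### Hilbert's different formula at a prime fixed by the group (Serre IV §1 Prop. 4) -/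

open scoped Pointwise in
/-- **Hilbert's different formula at a prime fixed by the group** (Serre, Ch. IV §1, Prop. 4:
`v_L(𝔇_{L/K}) = Σ_{s ≠ 1} i_G(s)`, in the global form of Remark 2).  Let `R` be Dedekind with
fraction field `K`, `L/K` finite Galois with group `G`, `𝔓 ≠ 0` a maximal ideal of
`S_L = integralClosure R L` with separable residue extension, and `F` an intermediate field whose
group `Gal(L/F) = F.fixingSubgroup` fixes `𝔓` (i.e. is contained in the decomposition group; in
Serre's complete local setting this is automatic).  Then the exponent of `𝔓` in the different of
`S_L` over `S_F = integralClosure R F` is `Σ_{s ∈ Gal(L/F), s ≠ 1} i_G(s)` (`i_G = Literature.lowerIndex`,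
which agrees with `i_{Gal(L/F)}` on `Gal(L/F)`, Prop. 2).  Proof (Serre's, globalised): Ch. III §6
Prop. 12 gives `x ∈ S_L`, `d ∈ S_F ∖ 𝔓` with `d S_L ⊆ S_F[x]` (`exists_generator_smul_mem_adjoin`),
so `i_G(s) = v_𝔓(s x - x)` on `Gal(L/F)` (Lemma IV.1.1, `lowerIndex_eq_ordIdeal`); the `s x`,
`s ∈ Gal(L/F)`, are pairwise distinct (`i_G(s) < ∞` for `s ≠ 1`), so the minimal polynomial of `x`
over `S_F` is `f = ∏_s (X - s x)` (it has the `s x` as roots and degree `≤ [L : F] = |Gal(L/F)|`),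
`x` generates `L/F`, `f'(x) = ∏_{s ≠ 1} (x - s x)`, and `𝔯 𝔇_{S_L/S_F} = (f'(x))` with `𝔯 ∌ 𝔓` the
conductor of `S_F[x]` (`d ∈ 𝔯`; Ch. III §6 Cor. 1 to Prop. 11, Mathlib's
`conductor_mul_differentIdeal`); take `v_𝔓`.
Ref: Serre, *Local Fields*, Ch. IV §1, Prop. 4 and its proof, Remark 2; Ch. III §6, Prop. 11,
Cor. 1–2, Prop. 12. [cite: SerreLocalFields1979, Ch. IV §1 Prop. 4] -/
theorem emultiplicity_differentIdeal_eq_finsum_lowerIndex [IsDedekindDomain (integralClosure R L)]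
    (F : IntermediateField K L) [IsDedekindDomain (integralClosure R F)]
    (𝔓 : Ideal (integralClosure R L)) [𝔓.IsMaximal] (h𝔓 : 𝔓 ≠ ⊥)
    [Algebra.IsSeparable (R ⧸ 𝔓.under R) (integralClosure R L ⧸ 𝔓)]
    (hF : F.fixingSubgroup ≤ 𝔓.decompositionSubgroup (L ≃ₐ[K] L)) :
    emultiplicity 𝔓 (differentIdeal (integralClosure R F) (integralClosure R L)) =
      ∑ᶠ (s : L ≃ₐ[K] L) (_ : s ∈ F.fixingSubgroup ∧ s ≠ 1),
        lowerIndex 𝔓 (L ≃ₐ[K] L) s := by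
  classical
  -- the data: `Γ = Gal(L/F)` acting on `S = S_L` with invariants `T = S_F`
  haveI : FaithfulSMul (L ≃ₐ[K] L) (integralClosure R L) := faithfulSMul_algEquiv_integralClosure R
  haveI hGal : IsGaloisGroup F.fixingSubgroup (integralClosure R F) (integralClosure R L) :=
    isGaloisGroup_fixingSubgroup_integralClosure R F
  haveI : Fintype F.fixingSubgroup := Fintype.ofFinite _
  haveI : IsFractionRing (integralClosure R F) F :=
    integralClosure.isFractionRing_of_finite_extension K F
  haveI : IsFractionRing (integralClosure R L) L :=
    integralClosure.isFractionRing_of_finite_extension K L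
  haveI : IsIntegralClosure (integralClosure R L) (integralClosure R F) L :=
    IsIntegralClosure.of_isIntegrallyClosedIn
  haveI h𝔓prime : 𝔓.IsPrime := Ideal.IsMaximal.isPrime inferInstance
  have hprime : Prime 𝔓 := Ideal.prime_of_isPrime h𝔓 inferInstance
  have hstab : ∀ g : F.fixingSubgroup, g • 𝔓 = 𝔓 := fun g => hF g.2
  -- separability of the residue extension of `𝔓` over `𝔓 ∩ S_F` (from that over `𝔓 ∩ R`)
  haveI : Algebra.IsSeparable (integralClosure R F ⧸ 𝔓.under (integralClosure R F))
      (integralClosure R L ⧸ 𝔓) := isSeparable_residue_top R F 𝔓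
  haveI : SMulCommClass F.fixingSubgroup (integralClosure R F) (integralClosure R L) :=
    hGal.commutes
  haveI : Algebra.IsInvariant (integralClosure R F) (integralClosure R L) F.fixingSubgroup :=
    hGal.isInvariant
  -- Serre III §6 Prop. 12 (global form) and Lemma IV.1.1: a generator `x` with
  -- `i_Γ(g) = v_𝔓(g x - x)`
  obtain ⟨x, d, hd, hgen⟩ :=
    exists_generator_smul_mem_adjoin (A := integralClosure R F) F.fixingSubgroup 𝔓 h𝔓 hstab
  have hi : ∀ g : F.fixingSubgroup,
      lowerIndex 𝔓 F.fixingSubgroup g = ordIdeal 𝔓 (g • x - x) :=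
    lowerIndex_eq_ordIdeal h𝔓 hstab hd hgen
  obtain ⟨Nb, hNb⟩ := Ideal.ramificationSubgroup_eventually_eq_bot_holds 𝔓 (L ≃ₐ[K] L)
    (Ideal.IsMaximal.ne_top inferInstance)
  have hne1 : ∀ g : F.fixingSubgroup, g ≠ 1 → g • x ≠ x := fun g hg h => by
    have h1 : (g : L ≃ₐ[K] L) ≠ 1 := fun h' => hg (Subtype.ext h')
    refine lowerIndex_ne_top 𝔓 (hNb Nb le_rfl) h1 ?_
    rw [← lowerIndex_subgroup, hi g, h, sub_self, ordIdeal_zero]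
  have hinj : Function.Injective fun g : F.fixingSubgroup => g • x := by
    intro g₁ g₂ h
    have : (g₂⁻¹ * g₁) • x = x := by rw [mul_smul, show g₁ • x = g₂ • x from h, inv_smul_smul]
    by_contra hne
    exact hne1 (g₂⁻¹ * g₁) (fun h' => hne (inv_mul_eq_one.mp h').symm) this
  -- the polynomial `Q = ∏_{g ∈ Γ} (X - g x)` is the minimal polynomial of `x` over `S_F`
  set Q : (integralClosure R L)[X] := ∏ g : F.fixingSubgroup, (X - C (g • x)) with hQ
  have hQmonic : Q.Monic := monic_prod_of_monic _ _ fun g _ => monic_X_sub_C _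
  have hQdeg : Q.natDegree = Fintype.card F.fixingSubgroup := by
    rw [hQ, natDegree_prod_of_monic _ _ fun g _ => monic_X_sub_C _]
    simp
  have hxint : IsIntegral (integralClosure R F) x := Algebra.IsIntegral.isIntegral x
  set P := minpoly (integralClosure R F) x with hP
  have hPmonic : P.Monic := minpoly.monic hxint
  have hQeq : Q = (Multiset.map (fun a => X - C a)
      ((Finset.univ : Finset F.fixingSubgroup).val.map fun g => g • x)).prod := by
    rw [hQ, Finset.prod_eq_multiset_prod, Multiset.map_map]; rfl
  have hdvd : Q ∣ P.map (algebraMap (integralClosure R F) (integralClosure R L)) := by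
    rw [hQeq, Multiset.prod_X_sub_C_dvd_iff_le_roots (hPmonic.map _).ne_zero,
      Multiset.le_iff_subset ((Finset.univ : Finset F.fixingSubgroup).nodup.map hinj)]
    intro a ha
    obtain ⟨g, -, rfl⟩ := Multiset.mem_map.mp ha
    rw [mem_roots (hPmonic.map _).ne_zero, IsRoot.def, eval_map_algebraMap, ← smul_aeval, hP,
      minpoly.aeval, smul_zero]
  have hfin : Module.finrank F L = Fintype.card F.fixingSubgroup := by
    rw [← Nat.card_eq_fintype_card]; exact (IsGalois.card_fixingSubgroup_eq_finrank F).symm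
  have hPx : minpoly F (x : L) = P.map (algebraMap (integralClosure R F) F) := by
    rw [hP, ← minpoly.algebraMap_eq (FaithfulSMul.algebraMap_injective (integralClosure R L) L) x]
    exact minpoly.isIntegrallyClosed_eq_field_fractions' F hxint.algebraMap
  have hdegP : P.natDegree ≤ Fintype.card F.fixingSubgroup := by
    have h1 : (minpoly F (x : L)).natDegree ≤ Module.finrank F L := minpoly.natDegree_le (x : L)
    rwa [hPx, hPmonic.natDegree_map, hfin] at h1
  have hPQ : P.map (algebraMap (integralClosure R F) (integralClosure R L)) = Q :=
    eq_of_monic_of_dvd_of_natDegree_le hQmonic (hPmonic.map _) hdvd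
      (by rw [hPmonic.natDegree_map, hQdeg]; exact hdegP)
  -- hence `x` generates `L/F`
  have hx : Algebra.adjoin F {((x : integralClosure R L) : L)} = ⊤ := by
    have hdeg : (minpoly F (x : L)).natDegree = Module.finrank F L := by
      rw [hPx, hPmonic.natDegree_map, hfin, ← hQdeg, ← hPQ, hPmonic.natDegree_map]
    have htop := (Field.primitive_element_iff_minpoly_natDegree_eq F (x : L)).mpr hdeg
    have halg : IsAlgebraic F (x : L) := Algebra.IsAlgebraic.isAlgebraic _
    rw [← IntermediateField.adjoin_simple_toSubalgebra_of_isAlgebraic halg, htop,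
      IntermediateField.top_toSubalgebra]
  -- Euler: `𝔣 · 𝔇_{S/S_F} = (P'(x))`, and `𝔣` is prime to `𝔓` (`d ∈ 𝔣`, `d ∉ 𝔓`)
  have hEuler := conductor_mul_differentIdeal (integralClosure R F) F L x hx
  have hcond : emultiplicity 𝔓 (conductor (integralClosure R F) x) = 0 := by
    rw [emultiplicity_eq_zero, Ideal.dvd_iff_le]
    intro hle
    refine hd (hle ?_)
    rw [mem_conductor_iff]
    intro b
    obtain ⟨Pb, hPb⟩ := hgen b
    rw [← Algebra.smul_def, hPb]
    exact aeval_mem_adjoin_singleton _ x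
  have hmul := congrArg (emultiplicity 𝔓) hEuler
  rw [emultiplicity_mul hprime, hcond, zero_add] at hmul
  -- `P'(x) = ∏_{g ≠ 1} (x - g x)`
  have hder : aeval x (derivative P) =
      ∏ g ∈ (Finset.univ : Finset F.fixingSubgroup).erase 1, (x - g • x) := by
    rw [← eval_map_algebraMap, ← derivative_map, hPQ, hQeq]
    have hxmem : x ∈ (Finset.univ : Finset F.fixingSubgroup).val.map fun g => g • x :=
      Multiset.mem_map.mpr ⟨1, Finset.mem_univ_val _, one_smul _ _⟩
    rw [eval_multiset_prod_X_sub_C_derivative hxmem]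
    have herase : ((Finset.univ : Finset F.fixingSubgroup).val.map fun g => g • x).erase x =
        ((Finset.univ : Finset F.fixingSubgroup).erase 1).val.map fun g => g • x := by
      rw [Finset.erase_val, Multiset.map_erase _ hinj, one_smul]
    rw [herase, Finset.prod_eq_multiset_prod, Multiset.map_map]
    rfl
  rw [hmul, hder, ordIdeal_prod h𝔓]
  -- both sides are `Σ_{g ∈ Γ, g ≠ 1} i(g)`
  rw [finsum_cond_eq_sum_of_cond_iff (t := ((Finset.univ : Finset F.fixingSubgroup).erase 1).map
      (Function.Embedding.subtype _)) _ (fun {s} _ => ?_), Finset.sum_map]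
  · refine Finset.sum_congr rfl fun g _ => ?_
    rw [ordIdeal_sub_comm, ← hi g, lowerIndex_subgroup]
    rfl
  · rw [Finset.mem_map]
    constructor
    · rintro ⟨hs, hs1⟩
      exact ⟨⟨s, hs⟩, Finset.mem_erase.mpr ⟨fun h => hs1 (congrArg Subtype.val h),
        Finset.mem_univ _⟩, rfl⟩
    · rintro ⟨g, hg, rfl⟩
      exact ⟨g.2, fun h => (Finset.mem_erase.mp hg).1 (Subtype.ext h)⟩

/-! ### Transitivity of the different, read off at a prime (Serre III §4 Prop. 8) -/

/-- **The different exponent along a tower** (transitivity of the different, Serre III §4 Prop. 8,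
read off at a prime): for finite torsion-free extensions of Dedekind domains `A → B → C` with
`Frac(C)/Frac(A)` separable and a maximal ideal `𝔓 ≠ 0` of `C`,
`v_𝔓(𝔇_{C/A}) = v_𝔓(𝔇_{C/B}) + e(𝔓 | 𝔓 ∩ B) · v_{𝔓 ∩ B}(𝔇_{B/A})`, from Mathlib's
`differentIdeal_eq_differentIdeal_mul_differentIdeal` (`𝔇_{C/A} = 𝔇_{C/B} · 𝔇_{B/A} C`) and
`v_𝔓(I C) = e · v_{𝔓 ∩ B}(I)` (`Ideal.IsDedekindDomain.emultiplicity_map_eq_ramificationIdx'_mul`);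
`𝔇_{B/A} ≠ 0` because `𝔇_{C/A} ≠ 0`.  Applied below to `S_{F₁} → S_{F₂} → S_L`.
Ref: Serre, *Local Fields*, Ch. III §4, Prop. 8. [cite: SerreLocalFields1979, Ch. III §4 Prop. 8] -/
theorem emultiplicity_differentIdeal_eq_add {A B C : Type*} [CommRing A] [CommRing B] [CommRing C]
    [IsDedekindDomain A] [IsDedekindDomain B] [IsDedekindDomain C] [Algebra A B] [Algebra B C]
    [Algebra A C] [IsScalarTower A B C] [Module.Finite A B] [Module.Finite A C] [Module.Finite B C]
    [Module.IsTorsionFree A B] [Module.IsTorsionFree A C] [Module.IsTorsionFree B C]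
    [Algebra.IsSeparable (FractionRing A) (FractionRing C)]
    (𝔓 : Ideal C) [𝔓.IsMaximal] (h𝔓 : 𝔓 ≠ ⊥) :
    emultiplicity 𝔓 (differentIdeal A C) =
      emultiplicity 𝔓 (differentIdeal B C) +
        (𝔓.under B).ramificationIdx' 𝔓 * emultiplicity (𝔓.under B) (differentIdeal A B) := by
  haveI : FaithfulSMul B C := Module.isTorsionFree_iff_faithfulSMul.mp inferInstance
  haveI : Algebra.IsIntegral B C := Algebra.IsIntegral.of_finite B C
  haveI h𝔓prime : 𝔓.IsPrime := Ideal.IsMaximal.isPrime inferInstance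
  have hprime : Prime 𝔓 := Ideal.prime_of_isPrime h𝔓 inferInstance
  have h𝔮 : 𝔓.under B ≠ ⊥ := Ideal.IsIntegral.comap_ne_bot _ h𝔓
  have htrans := differentIdeal_eq_differentIdeal_mul_differentIdeal A B C
  have hne : differentIdeal A B ≠ ⊥ := by
    intro h0
    apply differentIdeal_ne_bot (A := A) (B := C)
    rw [htrans, h0, Ideal.map_bot, Ideal.mul_bot]
  rw [htrans, emultiplicity_mul hprime,
    Ideal.IsDedekindDomain.emultiplicity_map_eq_ramificationIdx'_mul hne
      (Ideal.prime_of_isPrime h𝔮 inferInstance).irreducible hprime.irreducible h𝔓]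

/-! ### Serre IV §1, Corollary to Prop. 4: `|H ∩ G_0|` divides `Σ_{s ∉ H} i_G(s)` -/

set_option maxHeartbeats 1600000 in
omit [IsDedekindDomain R] [IsFractionRing R K] [FiniteDimensional K L] [IsGalois K L] in
open scoped Pointwise in
/-- **Discharge of `Literature.NumberTheory.GaloisRepresentations.card_inf_inertia_dvd_finsum_lowerIndex`: `|H ∩ G_0|` divides
`Σ_{s ∉ H} i_G(s)`** (Serre, Ch. IV §1, Corollary to Prop. 4:
`v_{K'}(𝔇_{K'/K}) = (1/e') Σ_{s ∉ H} i_G(s)`, `e' = e_{L/K'}`, in numerator form and globalised).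
Proof.  If `𝔓 = 0` every `i_G(s)`, `s ≠ 1`, vanishes.  Otherwise let `D = D_𝔓`, `F₁ = L^D`,
`F₂ = L^{H ∩ D}`, so that `Gal(L/F₂) = H ∩ D ≤ Gal(L/F₁) = D` fix `𝔓`.  By Hilbert's formula
(`emultiplicity_differentIdeal_eq_finsum_lowerIndex`) for `F₁` and `F₂` and the transitivity of the
different at `𝔓` (`emultiplicity_differentIdeal_eq_add`),
`Σ_{s ∈ D, s ≠ 1} i_G(s) = Σ_{s ∈ H ∩ D, s ≠ 1} i_G(s) + e(𝔓 | 𝔓 ∩ F₂) · v_{𝔓 ∩ F₂}(𝔇_{S_{F₂}/S_{F₁}})`,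
all terms being finite; hence `Σ_{s ∈ D ∖ H} i_G(s) = e(𝔓 | 𝔓 ∩ F₂) · v_{𝔓 ∩ F₂}(𝔇_{S_{F₂}/S_{F₁}})`.
Finally `i_G(s) = 0` for `s ∉ D`, and `e(𝔓 | 𝔓 ∩ F₂) = |T_𝔓 ∩ (H ∩ D)| = |H ∩ G_0|`
(`ramificationIdx'_under_eq_card_inertia`, `G_0 = T_𝔓 ≤ D`).
Ref: Serre, *Local Fields*, Ch. IV §1, Prop. 4 and Corollary (p. 64), Remark 2; Ch. III §4
Prop. 8. [cite: SerreLocalFields1979, Ch. IV §1, Cor. to Prop. 4] -/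
theorem card_inf_inertia_dvd_finsum_lowerIndex_holds :
    card_inf_inertia_dvd_finsum_lowerIndex R (K := K) (L := L) := by
  intro _ _ _ _ 𝔓 _ _ H
  classical
  haveI : IsDedekindDomain (integralClosure R L) := integralClosure.isDedekindDomain R K L
  haveI : FaithfulSMul (L ≃ₐ[K] L) (integralClosure R L) := faithfulSMul_algEquiv_integralClosure R
  haveI : Fintype (L ≃ₐ[K] L) := Fintype.ofFinite _
  -- `𝔓 = 0`: all `i_G(s)`, `s ≠ 1`, vanish
  by_cases h𝔓 : 𝔓 = ⊥
  · subst h𝔓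
    have h0 : ∀ s : L ≃ₐ[K] L, s ∉ H → (lowerIndex (⊥ : Ideal (integralClosure R L))
        (L ≃ₐ[K] L) s).toNat = 0 := fun s hs => by
      rw [lowerIndex_bot_of_ne_one (fun (h : s = 1) => hs (h ▸ H.one_mem)), ENat.toNat_zero]
    rw [finsum_cond_eq_sum_of_cond_iff (t := Finset.univ.filter fun s : L ≃ₐ[K] L => s ∉ H) _
      (by intro s _; simp only [Finset.mem_filter, Finset.mem_univ, true_and]),
      Finset.sum_eq_zero fun s hs => h0 s (Finset.mem_filter.mp hs).2]
    exact dvd_zero _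
  -- `𝔓 ≠ 0`: the decomposition group `D`, and the fixed fields of `D` and `H ∩ D`
  haveI h𝔓prime : 𝔓.IsPrime := Ideal.IsMaximal.isPrime inferInstance
  obtain ⟨Nb, hNb⟩ := Ideal.ramificationSubgroup_eventually_eq_bot_holds 𝔓 (L ≃ₐ[K] L)
    (Ideal.IsMaximal.ne_top inferInstance)
  have hfin : ∀ s : L ≃ₐ[K] L, s ≠ 1 → lowerIndex 𝔓 (L ≃ₐ[K] L) s ≠ ⊤ := fun s hs =>
    lowerIndex_ne_top 𝔓 (hNb Nb le_rfl) hs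
  set D : Subgroup (L ≃ₐ[K] L) := 𝔓.decompositionSubgroup (L ≃ₐ[K] L) with hD
  set F₁ : IntermediateField K L := IntermediateField.fixedField D with hF₁
  set F₂ : IntermediateField K L := IntermediateField.fixedField (H ⊓ D) with hF₂
  have hle : F₁ ≤ F₂ := fun y hy => (IntermediateField.mem_fixedField_iff _ _).mpr
    fun g hg => (IntermediateField.mem_fixedField_iff _ _).mp hy g hg.2
  haveI : IsDedekindDomain (integralClosure R F₁) := integralClosure.isDedekindDomain R K F₁
  haveI : IsDedekindDomain (integralClosure R F₂) := integralClosure.isDedekindDomain R K F₂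
  -- the inclusion `S_{F₁} → S_{F₂}` and the tower `S_{F₁} → S_{F₂} → S_L`
  letI alg₁₂ : Algebra (integralClosure R F₁) (integralClosure R F₂) :=
    (((IntermediateField.inclusion hle).restrictScalars R).mapIntegralClosure).toRingHom.toAlgebra
  letI smul₁₂ : SMul (integralClosure R F₁) (integralClosure R F₂) := alg₁₂.toSMul
  letI mod₁₂ : Module (integralClosure R F₁) (integralClosure R F₂) := alg₁₂.toModule
  haveI : IsScalarTower (integralClosure R F₁) (integralClosure R F₂) (integralClosure R L) :=
    IsScalarTower.of_algebraMap_eq fun _ => Subtype.ext rfl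
  haveI : IsScalarTower R (integralClosure R F₁) (integralClosure R F₂) :=
    IsScalarTower.of_algebraMap_eq fun _ => Subtype.ext rfl
  haveI : FaithfulSMul (integralClosure R F₁) (integralClosure R F₂) := by
    refine (faithfulSMul_iff_algebraMap_injective _ _).mpr fun a b h => ?_
    have h' := congrArg (fun z : integralClosure R F₂ => ((z : F₂) : L)) h
    exact Subtype.ext (Subtype.ext h')
  haveI : Module.IsTorsionFree (integralClosure R F₁) (integralClosure R F₂) := by
    rw [Module.isTorsionFree_iff_faithfulSMul]; infer_instance
  haveI : Module.Finite (integralClosure R F₁) (integralClosure R F₂) := by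
    haveI : Module.Finite R (integralClosure R F₂) :=
      IsIntegralClosure.finite R K F₂ (integralClosure R F₂)
    exact Module.Finite.of_restrictScalars_finite R _ _
  letI aS : Algebra (integralClosure R L) (FractionRing (integralClosure R L)) :=
    OreLocalization.instAlgebra
  letI sS : SMul (integralClosure R L) (FractionRing (integralClosure R L)) := aS.toSMul
  letI a₁ : Algebra (integralClosure R F₁) (FractionRing (integralClosure R L)) :=
    OreLocalization.instAlgebra
  letI s₁ : SMul (integralClosure R F₁) (FractionRing (integralClosure R L)) := a₁.toSMul
  haveI : IsScalarTower (integralClosure R F₁) (integralClosure R L)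
      (FractionRing (integralClosure R L)) :=
    IsScalarTower.of_algebraMap_eq fun _ => rfl
  haveI : FaithfulSMul (integralClosure R F₁) (FractionRing (integralClosure R L)) :=
    FractionRing.instFaithfulSMul _ _
  letI a₁₁ : Algebra (integralClosure R F₁) (FractionRing (integralClosure R F₁)) :=
    OreLocalization.instAlgebra
  letI s₁₁ : SMul (integralClosure R F₁) (FractionRing (integralClosure R F₁)) := a₁₁.toSMul
  letI aFF : Algebra (FractionRing (integralClosure R F₁)) (FractionRing (integralClosure R L)) :=
    FractionRing.liftAlgebra _ _
  letI sFF : SMul (FractionRing (integralClosure R F₁)) (FractionRing (integralClosure R L)) :=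
    aFF.toSMul
  haveI : IsScalarTower (integralClosure R F₁) (FractionRing (integralClosure R F₁))
      (FractionRing (integralClosure R L)) :=
    FractionRing.isScalarTower_liftAlgebra _ _
  -- separability of `Frac(S_L)/Frac(S_{F₁})`, transported from `L/F₁`
  haveI : Algebra.IsSeparable (FractionRing (integralClosure R F₁))
      (FractionRing (integralClosure R L)) := by
    haveI : IsFractionRing (integralClosure R F₁) F₁ :=
      integralClosure.isFractionRing_of_finite_extension K F₁
    haveI : IsFractionRing (integralClosure R L) L :=
      integralClosure.isFractionRing_of_finite_extension K L
    refine Algebra.IsSeparable.of_equiv_equiv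
      (FractionRing.algEquiv (integralClosure R F₁) F₁).symm.toRingEquiv
      (FractionRing.algEquiv (integralClosure R L) L).symm.toRingEquiv ?_
    ext _
    exact IsFractionRing.algEquiv_commutes (FractionRing.algEquiv (integralClosure R F₁) F₁).symm
      (FractionRing.algEquiv (integralClosure R L) L).symm _
  have hΓ₁ : F₁.fixingSubgroup = D := IntermediateField.fixingSubgroup_fixedField D
  have hΓ₂ : F₂.fixingSubgroup = H ⊓ D := IntermediateField.fixingSubgroup_fixedField _
  -- Hilbert's formula for `L/F₁` and `L/F₂`, and transitivity along `S_{F₁} → S_{F₂} → S_L`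
  have HT := emultiplicity_differentIdeal_eq_add (A := integralClosure R F₁)
    (B := integralClosure R F₂) 𝔓 h𝔓
  rw [emultiplicity_differentIdeal_eq_finsum_lowerIndex R F₁ 𝔓 h𝔓 hΓ₁.le,
    emultiplicity_differentIdeal_eq_finsum_lowerIndex R F₂ 𝔓 h𝔓 (hΓ₂.le.trans inf_le_right),
    finsum_cond_eq_sum_of_cond_iff (t := Finset.univ.filter fun s => s ∈ D ∧ s ≠ 1) _
      (by intro s _; simp only [Finset.mem_filter, Finset.mem_univ, true_and, hΓ₁]),
    finsum_cond_eq_sum_of_cond_iff (t := Finset.univ.filter fun s => s ∈ H ⊓ D ∧ s ≠ 1) _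
      (by intro s _; simp only [Finset.mem_filter, Finset.mem_univ, true_and, hΓ₂]),
    ← Finset.sum_filter_add_sum_filter_not (Finset.univ.filter fun s => s ∈ D ∧ s ≠ 1) (· ∈ H),
    Finset.filter_filter, Finset.filter_filter] at HT
  set e := (𝔓.under (integralClosure R F₂)).ramificationIdx' 𝔓 with he
  set m := emultiplicity (𝔓.under (integralClosure R F₂))
    (differentIdeal (integralClosure R F₁) (integralClosure R F₂)) with hm
  have hX : (Finset.univ.filter fun s : L ≃ₐ[K] L => (s ∈ D ∧ s ≠ 1) ∧ s ∈ H) =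
      Finset.univ.filter fun s => s ∈ H ⊓ D ∧ s ≠ 1 :=
    Finset.filter_congr fun s _ => by rw [Subgroup.mem_inf]; tauto
  have hY : (Finset.univ.filter fun s : L ≃ₐ[K] L => (s ∈ D ∧ s ≠ 1) ∧ s ∉ H) =
      Finset.univ.filter fun s => s ∈ D ∧ s ∉ H :=
    Finset.filter_congr fun s _ =>
      ⟨fun h => ⟨h.1.1, h.2⟩, fun h => ⟨⟨h.1, fun (h1 : s = 1) => h.2 (h1 ▸ H.one_mem)⟩, h.2⟩⟩
  rw [hX, hY] at HT
  have hXfin : ∑ s ∈ Finset.univ.filter (fun s : L ≃ₐ[K] L => s ∈ H ⊓ D ∧ s ≠ 1),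
      lowerIndex 𝔓 (L ≃ₐ[K] L) s ≠ ⊤ :=
    WithTop.sum_ne_top.2 fun s hs => hfin s (Finset.mem_filter.mp hs).2.2
  have hYeq : ∑ s ∈ Finset.univ.filter (fun s : L ≃ₐ[K] L => s ∈ D ∧ s ∉ H),
      lowerIndex 𝔓 (L ≃ₐ[K] L) s = e * m := WithTop.add_left_cancel hXfin HT
  have hYfin : ∑ s ∈ Finset.univ.filter (fun s : L ≃ₐ[K] L => s ∈ D ∧ s ∉ H),
      lowerIndex 𝔓 (L ≃ₐ[K] L) s ≠ ⊤ :=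
    WithTop.sum_ne_top.2 fun s hs => hfin s fun (h1 : s = 1) =>
      (Finset.mem_filter.mp hs).2.2 (h1 ▸ H.one_mem)
  -- `e = |H ∩ G_0|`
  have he' : e = Nat.card ↥(H ⊓ 𝔓.inertia (L ≃ₐ[K] L)) := by
    rw [he, ramificationIdx'_under_eq_card_inertia R F₂ 𝔓 h𝔓,
      Nat.card_congr ((𝔓.inertia ↥F₂.fixingSubgroup).equivMapOfInjective
        F₂.fixingSubgroup.subtype F₂.fixingSubgroup.subtype_injective).toEquiv,
      AddSubgroup.inertia_map_subtype 𝔓.toAddSubgroup F₂.fixingSubgroup, hΓ₂]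
    congr 2
    refine le_antisymm (le_inf (inf_le_right.trans inf_le_left) inf_le_left)
      (le_inf inf_le_right (le_inf inf_le_left (inf_le_right.trans ?_)))
    exact Ideal.inertia_le_stabilizer 𝔓
  have he0 : (e : ℕ∞) ≠ 0 := by
    rw [he']; exact_mod_cast Nat.card_pos.ne'
  have hmfin : m ≠ ⊤ := fun htop => hYfin (by rw [hYeq, htop, ENat.mul_top he0])
  obtain ⟨k, hk⟩ := ENat.ne_top_iff_exists.mp hmfin
  -- the statement: only `s ∈ D ∖ H` contribute to `Σ_{s ∉ H} i_G(s)`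
  rw [finsum_cond_eq_sum_of_cond_iff (t := Finset.univ.filter fun s : L ≃ₐ[K] L => s ∉ H) _
      (by intro s _; simp only [Finset.mem_filter, Finset.mem_univ, true_and]),
    ← Finset.sum_filter_add_sum_filter_not (Finset.univ.filter fun s : L ≃ₐ[K] L => s ∉ H)
      (· ∈ D), Finset.filter_filter, Finset.filter_filter]
  have hzero : ∑ s ∈ Finset.univ.filter (fun s : L ≃ₐ[K] L => s ∉ H ∧ s ∉ D),
      (lowerIndex 𝔓 (L ≃ₐ[K] L) s).toNat = 0 :=
    Finset.sum_eq_zero fun s hs => by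
      rw [lowerIndex_eq_zero_of_smul_ne (Finset.mem_filter.mp hs).2.2, ENat.toNat_zero]
  have hfilt : (Finset.univ.filter fun s : L ≃ₐ[K] L => s ∉ H ∧ s ∈ D) =
      Finset.univ.filter fun s => s ∈ D ∧ s ∉ H :=
    Finset.filter_congr fun s _ => and_comm
  rw [hzero, add_zero, hfilt]
  have hcast : ((∑ s ∈ Finset.univ.filter (fun s : L ≃ₐ[K] L => s ∈ D ∧ s ∉ H),
      (lowerIndex 𝔓 (L ≃ₐ[K] L) s).toNat : ℕ) : ℕ∞) =
        (Nat.card ↥(H ⊓ 𝔓.inertia (L ≃ₐ[K] L)) : ℕ∞) * k := by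
    rw [← he', hk, ← hYeq, Nat.cast_sum]
    refine Finset.sum_congr rfl fun s hs => ENat.coe_toNat (hfin s fun (h1 : s = 1) => ?_)
    exact (Finset.mem_filter.mp hs).2.2 (h1 ▸ H.one_mem)
  exact ⟨k, by exact_mod_cast hcast⟩

end Literature.NumberTheory.GaloisRepresentations

end
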